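import Summits.Parity.GeneralizedHardyLittlewood.Theorems.LeeYangFibresAbsoluteUpgradeModGammaAdjointEqStep
import HarnessLib

/-!
# Route `LeeYangFibres`, crux `AbsoluteUpgrade` (stmt-Parity-14116), line `dip-margin-rate-exchange`:
# the adjoint method for `ModGammaDisc` — the adjoint equation on the half-plane `Re z > -1`
# (helper #3 for the stub `mg_adjointEq`)

Helper file for the registered stub `mg_adjointEq : MGEin → MGAdjointEq`: the UNREGULARISED case.
For `Re z > -1` the adjoint `g_z(w) = ∫_0^∞ e^{-wx} x^z φ_z(x) dx` (`φ_z = e^{-z Ein}`) converges at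
`x = 0⁺` without regularisation, and:

* (B) `AdjEq.adjTilde_eq_of_re_gt` — the regularised `Γ`-normalised adjoint of the vocabulary file IS
  `e^{γz} Γ(1+z)⁻¹ g_z(w)`: split `∫ e^{-wx} x^{z+N} R_N = ∫ e^{-wx} x^z φ_z - Σ_{k<N} p_k ∫ e^{-wx} x^{z+k}`,
  evaluate the Gamma integrals (`Complex.integral_cpow_mul_exp_neg_mul_Ioi`) and use
  `Γ(z+k+1)/Γ(z+1) = (z+1)⋯(z+k)`;
* (A) `AdjEq.hasDerivAt_mul_integral_phiZ` — `d/dw [w g_z(w)] = -z g_z(w+1)`: differentiate under the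
  integral sign (helper #2) and integrate by parts `d/dx[e^{-vx} x^{z+1} φ_z] = e^{-vx}x^zφ_z(1 - vx + ze^{-x})`
  over `(0, ∞)` (kernel identity `x φ_z' = -z(1 - e^{-x})φ_z`), exactly as in the tree's `x^z`-free
  template `Literature.NumberTheory.Sieve.rosserAdjointP.integral_one_sub_mul` [Greaves2001, §4.2.3
  (3.4)–(3.6)];
* `mg_adjointEq_halfPlane` (registered helper) — (A)+(B): the adjoint equation
  `d/dv [v · adjTilde N z v] = -z · adjTilde N z (v+1)` for every `N`, `Re z > -1`, `v > 0`.

References: G. Greaves, *Sieves in Number Theory* (2001), §4.2.3 [Greaves2001].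
-/

noncomputable section

namespace Summit.Parity.GeneralizedHardyLittlewood.Cruxes.AbsoluteUpgrade.DipMarginRateExchange

open scoped BigOperators
open MeasureTheory Set Filter Topology
open Literature.NumberTheory.Sieve (ein einKernel)

namespace AdjEq

/-! ## The unregularised kernel `x^z φ_z(x)` for `Re z > -1` -/

/-- `d/dt e^{-vt} = -v e^{-vt}` (real `t`, complex values). -/
theorem hasDerivAt_cexp_neg_mul_ofReal (v t : ℝ) :
    HasDerivAt (fun t : ℝ => Complex.exp (-((v : ℂ) * t)))
      (-(v : ℂ) * Complex.exp (-((v : ℂ) * t))) t := by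
  have h2 : HasDerivAt (fun t : ℝ => -((v : ℂ) * t)) (-((v : ℂ) * 1)) t :=
    ((hasDerivAt_ofReal t).const_mul (v : ℂ)).neg
  convert h2.cexp using 1
  ring

/-- The unregularised kernel: `‖x^z φ_z(x)‖ ≤ e^{‖z‖} (x^{Re z} + x^{Re z + ‖z‖})` for `x > 0`. -/
theorem norm_cpow_mul_phiZ_le (hE : MGEin) (z : ℂ) {x : ℝ} (hx : 0 < x) :
    ‖(x : ℂ) ^ z * phiZ z x‖ ≤ Real.exp ‖z‖ * (x ^ z.re + x ^ (z.re + ‖z‖)) := by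
  rw [norm_mul, Complex.norm_cpow_eq_rpow_re_of_pos hx]
  calc x ^ z.re * ‖phiZ z x‖ ≤ x ^ z.re * (Real.exp ‖z‖ * (1 + x ^ ‖z‖)) :=
        mul_le_mul_of_nonneg_left (norm_phiZ_ofReal_le_rpow hE z hx.le) (Real.rpow_nonneg hx.le _)
    _ = Real.exp ‖z‖ * (x ^ z.re + x ^ z.re * x ^ ‖z‖) := by ring
    _ = Real.exp ‖z‖ * (x ^ z.re + x ^ (z.re + ‖z‖)) := by rw [← Real.rpow_add hx]

/-- `x ↦ x^e φ_z(x)` is continuous on `(0, ∞)`. -/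
theorem continuousOn_cpow_mul_phiZ (hE : MGEin) (z e : ℂ) :
    ContinuousOn (fun x : ℝ => (x : ℂ) ^ e * phiZ z x) (Ioi 0) :=
  (continuousOn_ofReal_cpow e).mul ((continuous_phiZ hE z).comp Complex.continuous_ofReal).continuousOn

/-- Integrability of `x^m e^{-wx} x^z φ_z(x)` on `(0, ∞)` for `Re z > -1`, `w > 0`. -/
theorem integrableOn_pow_mul_cexp_cpow_phiZ (hE : MGEin) {z : ℂ} (hz : -1 < z.re) {w : ℝ}
    (hw : 0 < w) (m : ℕ) :
    IntegrableOn (fun x : ℝ => (x : ℂ) ^ m *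
      (Complex.exp (-((w : ℂ) * x)) * (x : ℂ) ^ z * phiZ z x)) (Ioi 0) := by
  have hcont : ContinuousOn (fun x : ℝ => (x : ℂ) ^ m *
      (Complex.exp (-((w : ℂ) * x)) * (x : ℂ) ^ z * phiZ z x)) (Ioi 0) := by
    refine (Continuous.continuousOn (by fun_prop)).mul ?_
    simp_rw [mul_assoc]
    exact (Continuous.continuousOn (by fun_prop)).mul (continuousOn_cpow_mul_phiZ hE z z)
  have ha : (-1:ℝ) < m + z.re := by have := (Nat.cast_nonneg m : (0:ℝ) ≤ m); linarith
  have hb : (-1:ℝ) < m + (z.re + ‖z‖) := by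
    have := (Nat.cast_nonneg m : (0:ℝ) ≤ m); linarith [norm_nonneg z]
  refine Integrable.mono' (((integrableOn_rpow_mul_exp_neg_mul ha hw).add
    (integrableOn_rpow_mul_exp_neg_mul hb hw)).const_mul (Real.exp ‖z‖))
    (hcont.aestronglyMeasurable measurableSet_Ioi) ?_
  refine (ae_restrict_mem measurableSet_Ioi).mono fun x (hx : 0 < x) => ?_
  rw [norm_mul, mul_assoc (Complex.exp _), norm_mul, norm_cexp_neg_ofReal_mul, norm_pow,
    Complex.norm_real, Real.norm_of_nonneg hx.le]
  have hma : x ^ ((m:ℝ) + z.re) = x ^ m * x ^ z.re := by rw [Real.rpow_add hx, Real.rpow_natCast]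
  have hmb : x ^ ((m:ℝ) + (z.re + ‖z‖)) = x ^ m * x ^ (z.re + ‖z‖) := by
    rw [Real.rpow_add hx, Real.rpow_natCast]
  simp only [Pi.add_apply]
  calc x ^ m * (Real.exp (-(w * x)) * ‖(x : ℂ) ^ z * phiZ z x‖)
      ≤ x ^ m * (Real.exp (-(w * x)) * (Real.exp ‖z‖ * (x ^ z.re + x ^ (z.re + ‖z‖)))) := by
        gcongr; exact norm_cpow_mul_phiZ_le hE z hx
    _ = Real.exp ‖z‖ * (x ^ ((m:ℝ) + z.re) * Real.exp (-(w * x)) +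
          x ^ ((m:ℝ) + (z.re + ‖z‖)) * Real.exp (-(w * x))) := by rw [hma, hmb]; ring

/-- Integrability of `e^{-wx} x^z φ_z(x)` on `(0, ∞)` for `Re z > -1`, `w > 0`. -/
theorem integrableOn_cexp_cpow_phiZ (hE : MGEin) {z : ℂ} (hz : -1 < z.re) {w : ℝ} (hw : 0 < w) :
    IntegrableOn (fun x : ℝ => Complex.exp (-((w : ℂ) * x)) * (x : ℂ) ^ z * phiZ z x) (Ioi 0) := by
  simpa only [pow_zero, one_mul] using integrableOn_pow_mul_cexp_cpow_phiZ hE hz hw 0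

/-- Integrability of `x e^{-wx} x^z φ_z(x)` on `(0, ∞)` for `Re z > -1`, `w > 0`. -/
theorem integrableOn_mul_cexp_cpow_phiZ (hE : MGEin) {z : ℂ} (hz : -1 < z.re) {w : ℝ} (hw : 0 < w) :
    IntegrableOn (fun x : ℝ => (x : ℂ) *
      (Complex.exp (-((w : ℂ) * x)) * (x : ℂ) ^ z * phiZ z x)) (Ioi 0) := by
  simpa only [pow_one] using integrableOn_pow_mul_cexp_cpow_phiZ hE hz hw 1
/-! ## (B) regularised = unregularised for `Re z > -1` -/

/-- `Γ(z+k+1)/Γ(z+1) = (z+1)(z+2)⋯(z+k)` for `Re z > -1` (`Complex.Gamma_add_one`). [folklore] -/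
theorem Gamma_inv_mul_Gamma_add (z : ℂ) (hz : -1 < z.re) (k : ℕ) :
    (Complex.Gamma (1 + z))⁻¹ * Complex.Gamma (z + ((k : ℂ) + 1)) =
      ∏ i ∈ Finset.range k, (z + ((i : ℂ) + 1)) := by
  induction k with
  | zero =>
    simp only [Nat.cast_zero, zero_add, Finset.range_zero, Finset.prod_empty]
    rw [add_comm z 1, inv_mul_cancel₀]
    exact Complex.Gamma_ne_zero_of_re_pos (by simp; linarith)
  | succ k ih =>
    rw [Finset.prod_range_succ, ← ih]
    have hne : z + ((k : ℂ) + 1) ≠ 0 := by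
      intro h; have := congrArg Complex.re h; simp at this; linarith
    push_cast
    rw [show z + ((k : ℂ) + 1 + 1) = z + ((k : ℂ) + 1) + 1 by ring, Complex.Gamma_add_one _ hne]
    ring

/-- **The regularised integral is the unregularised one minus Gamma terms** (`Re z > -1`, `w > 0`):
`∫_0^∞ e^{-wx} x^{z+N} R_N = ∫_0^∞ e^{-wx} x^z φ_z - Σ_{k<N} p_k(z) Γ(z+k+1) w^{-(z+k+1)}`
(`Complex.integral_cpow_mul_exp_neg_mul_Ioi`). -/
theorem integral_remZ_eq_of_re_gt (hE : MGEin) (N : ℕ) {z : ℂ} (hz : -1 < z.re) {w : ℝ}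
    (hw : 0 < w) :
    ∫ x in Ioi (0:ℝ), Complex.exp (-((w : ℂ) * x)) * ((x : ℂ) ^ (z + (N : ℂ))) * remZ N z x =
      (∫ x in Ioi (0:ℝ), Complex.exp (-((w : ℂ) * x)) * (x : ℂ) ^ z * phiZ z x) -
        ∑ k ∈ Finset.range N, pCoeff z k *
          ((1 / (w : ℂ)) ^ (z + ((k : ℂ) + 1)) * Complex.Gamma (z + ((k : ℂ) + 1))) := by
  have hterm : ∀ k : ℕ, IntegrableOn (fun x : ℝ => (x : ℂ) ^ (z + ((k:ℂ) + 1) - 1) *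
      Complex.exp (-((w : ℂ) * x))) (Ioi 0) ∧
      ∫ x in Ioi (0:ℝ), (x : ℂ) ^ (z + ((k:ℂ) + 1) - 1) * Complex.exp (-((w : ℂ) * x)) =
        (1 / (w : ℂ)) ^ (z + ((k : ℂ) + 1)) * Complex.Gamma (z + ((k : ℂ) + 1)) := by
    intro k
    have hk0 := (Nat.cast_nonneg k : (0:ℝ) ≤ k)
    have ha : 0 < (z + ((k:ℂ) + 1)).re := by simp; linarith
    refine ⟨?_, Complex.integral_cpow_mul_exp_neg_mul_Ioi ha hw⟩
    have hcont : ContinuousOn (fun x : ℝ => (x : ℂ) ^ (z + ((k:ℂ) + 1) - 1) *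
        Complex.exp (-((w : ℂ) * x))) (Ioi 0) :=
      (continuousOn_ofReal_cpow _).mul (Continuous.continuousOn (by fun_prop))
    refine Integrable.mono' (integrableOn_rpow_mul_exp_neg_mul (a := z.re + k) (by linarith) hw)
      (hcont.aestronglyMeasurable measurableSet_Ioi) ?_
    refine (ae_restrict_mem measurableSet_Ioi).mono fun x (hx : 0 < x) => ?_
    have hre : (z + ((k:ℂ) + 1) - 1).re = z.re + k := by
      simp only [Complex.sub_re, Complex.add_re, Complex.one_re, Complex.natCast_re]; ring
    rw [norm_mul, norm_cexp_neg_ofReal_mul, Complex.norm_cpow_eq_rpow_re_of_pos hx, hre]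
  have hpt : EqOn (fun x : ℝ => Complex.exp (-((w : ℂ) * x)) * ((x : ℂ) ^ (z + (N : ℂ))) * remZ N z x)
      (fun x : ℝ => Complex.exp (-((w : ℂ) * x)) * (x : ℂ) ^ z * phiZ z x -
        ∑ k ∈ Finset.range N, pCoeff z k * ((x : ℂ) ^ (z + ((k:ℂ) + 1) - 1) *
          Complex.exp (-((w : ℂ) * x)))) (Ioi 0) := by
    intro x hx
    have hx' : 0 < x := hx
    have hx0 : (x:ℂ) ≠ 0 := Complex.ofReal_ne_zero.mpr hx'.ne'
    dsimp only
    rw [mul_assoc, cpow_mul_remZ hx', mul_sub, mul_sub, ← mul_assoc, Finset.mul_sum, Finset.mul_sum]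
    congr 1
    refine Finset.sum_congr rfl fun k _ => ?_
    rw [show z + ((k:ℂ) + 1) - 1 = z + (k:ℂ) by ring, Complex.cpow_add _ _ hx0, Complex.cpow_natCast]
    ring
  have hI : ∀ k ∈ Finset.range N, Integrable (fun x : ℝ => pCoeff z k *
      ((x : ℂ) ^ (z + ((k:ℂ) + 1) - 1) * Complex.exp (-((w : ℂ) * x)))) (volume.restrict (Ioi 0)) :=
    fun k _ => (hterm k).1.const_mul _
  rw [setIntegral_congr_fun measurableSet_Ioi hpt, integral_sub (integrableOn_cexp_cpow_phiZ hE hz hw)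
    (integrable_finsetSum _ hI), integral_finsetSum _ hI]
  congr 1
  refine Finset.sum_congr rfl fun k _ => ?_
  rw [integral_const_mul, (hterm k).2]

/-- **(B) For `Re z > -1` the regularised normalised adjoint is the unregularised one**: `adjTilde N z w
= e^{γz} Γ(1+z)⁻¹ ∫_0^∞ e^{-wx} x^z φ_z(x) dx` (the Gamma terms cancel against the power sum since
`Γ(z+k+1)/Γ(1+z) = (z+1)⋯(z+k)`). -/
theorem adjTilde_eq_of_re_gt (hE : MGEin) (N : ℕ) {z : ℂ} (hz : -1 < z.re) {w : ℝ} (hw : 0 < w) :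
    adjTilde N z w = Complex.exp ((Real.eulerMascheroniConstant : ℂ) * z) *
      (Complex.Gamma (1 + z))⁻¹ *
        ∫ x in Ioi (0:ℝ), Complex.exp (-((w : ℂ) * x)) * (x : ℂ) ^ z * phiZ z x := by
  have harg : (w : ℂ).arg ≠ Real.pi := by
    rw [Complex.arg_ofReal_of_nonneg hw.le]; exact Real.pi_ne_zero.symm
  rw [adjTilde, integral_remZ_eq_of_re_gt hE N hz hw]
  have hk : ∀ k ∈ Finset.range N, pCoeff z k * (∏ i ∈ Finset.range k, (z + ((i : ℂ) + 1))) *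
      (w : ℂ) ^ (-(z + ((k : ℂ) + 1))) =
      (Complex.Gamma (1 + z))⁻¹ * (pCoeff z k * ((1 / (w : ℂ)) ^ (z + ((k : ℂ) + 1)) *
        Complex.Gamma (z + ((k : ℂ) + 1)))) := by
    intro k _
    rw [← Gamma_inv_mul_Gamma_add z hz k, one_div, Complex.inv_cpow _ _ harg, Complex.cpow_neg]
    ring
  rw [Finset.sum_congr rfl hk, ← Finset.mul_sum]
  ring
/-! ## (A) the adjoint equation by integration by parts -/

/-- **The integration by parts behind the adjoint equation** (`Re z > -1`, `v > 0`): `∫ e^{-vx} x^z φ_z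
- v ∫ x e^{-vx} x^z φ_z + z ∫ e^{-(v+1)x} x^z φ_z = 0`, from `d/dx [e^{-vx} x^{z+1} φ_z(x)] =
e^{-vx} x^z φ_z(x) (1 - vx + z e^{-x})` (kernel identity `x φ_z' = -z (1 - e^{-x}) φ_z`), the
boundary terms vanishing (`Re z > -1` at `0⁺`, exponential decay at `∞`); cf. [Greaves2001, §4.2.3
(3.4)–(3.6)] and the tree's `rosserAdjointP.integral_one_sub_mul`. -/
theorem integral_ibp_phiZ (hE : MGEin) {z : ℂ} (hz : -1 < z.re) {v : ℝ} (hv : 0 < v) :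
    (∫ x in Ioi (0:ℝ), Complex.exp (-((v : ℂ) * x)) * (x : ℂ) ^ z * phiZ z x) -
      (v : ℂ) * (∫ x in Ioi (0:ℝ), (x : ℂ) *
        (Complex.exp (-((v : ℂ) * x)) * (x : ℂ) ^ z * phiZ z x)) +
      z * ∫ x in Ioi (0:ℝ), Complex.exp (-(((v + 1 : ℝ) : ℂ) * x)) * (x : ℂ) ^ z * phiZ z x = 0 := by
  set u : ℝ → ℂ := fun x => Complex.exp (-((v : ℂ) * x)) * (x : ℂ) ^ (z + 1) * phiZ z x with hu
  set u' : ℝ → ℂ := fun x => Complex.exp (-((v : ℂ) * x)) * (x : ℂ) ^ z * phiZ z x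
      - (v : ℂ) * ((x : ℂ) * (Complex.exp (-((v : ℂ) * x)) * (x : ℂ) ^ z * phiZ z x))
      + z * (Complex.exp (-(((v + 1 : ℝ) : ℂ) * x)) * (x : ℂ) ^ z * phiZ z x) with hu'
  have hz1 : z + 1 ≠ 0 := by
    intro h; have := congrArg Complex.re h; simp at this; linarith
  have hz1re : 0 < (z + 1).re := by simp; linarith
  -- the derivative on `(0, ∞)`
  have hderiv : ∀ x ∈ Ioi (0:ℝ), HasDerivAt u (u' x) x := by
    intro x hx
    have hx' : 0 < x := hx
    have hx0 : (x : ℂ) ≠ 0 := Complex.ofReal_ne_zero.mpr hx'.ne'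
    have hP : HasDerivAt (fun t : ℝ => (t : ℂ) ^ (z + 1)) ((z + 1) * (x : ℂ) ^ z) x := by
      have := hasDerivAt_ofReal_cpow_const_of_ne hx'.ne' (z + 1)
      rwa [add_sub_cancel_right] at this
    have hEx := hasDerivAt_cexp_neg_mul_ofReal v x
    have hΦ := hasDerivAt_phiZ_ofReal hE z x
    have hprod := (hEx.fun_mul hP).fun_mul hΦ
    refine hprod.congr_deriv ?_
    have hP1 : (x : ℂ) ^ (z + 1) = (x : ℂ) ^ z * x := by
      rw [Complex.cpow_add _ _ hx0, Complex.cpow_one]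
    have hκ : (x : ℂ) * ((einKernel x : ℝ) : ℂ) = 1 - Complex.exp (-(x : ℂ)) := by
      have h := Literature.NumberTheory.Sieve.mul_einKernel x
      have h' : ((x * einKernel x : ℝ) : ℂ) = ((1 - Real.exp (-x) : ℝ) : ℂ) := by rw [h]
      push_cast at h'
      exact h'
    have hE1 : Complex.exp (-(((v + 1 : ℝ) : ℂ) * x)) =
        Complex.exp (-((v : ℂ) * x)) * Complex.exp (-(x : ℂ)) := by
      rw [← Complex.exp_add]; push_cast; ring_nf
    rw [hu']
    dsimp only
    rw [hE1, hP1]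
    linear_combination (-(z * Complex.exp (-((v : ℂ) * x)) * (x : ℂ) ^ z * phiZ z x)) * hκ
  -- continuity and the value at `0`
  have hcont : Continuous u := by
    have h1 : Continuous fun t : ℝ => (t : ℂ) ^ (z + 1) := Complex.continuous_ofReal_cpow_const hz1re
    exact ((by fun_prop : Continuous fun t : ℝ => Complex.exp (-((v : ℂ) * t))).mul h1).mul
      ((continuous_phiZ hE z).comp Complex.continuous_ofReal)
  have hu0 : u 0 = 0 := by simp [hu, Complex.zero_cpow hz1]
  -- the limit at infinity
  have hlim : Tendsto u atTop (𝓝 0) := by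
    have hb : ∀ x : ℝ, 0 < x → ‖u x‖ ≤ Real.exp ‖z‖ * (x ^ (z.re + 1) * Real.exp (-(v * x)) +
        x ^ (z.re + 1 + ‖z‖) * Real.exp (-(v * x))) := by
      intro x hx
      rw [hu]
      dsimp only
      rw [mul_assoc, norm_mul, norm_cexp_neg_ofReal_mul, norm_mul,
        Complex.norm_cpow_eq_rpow_re_of_pos hx]
      simp only [Complex.add_re, Complex.one_re]
      calc Real.exp (-(v * x)) * (x ^ (z.re + 1) * ‖phiZ z x‖)
          ≤ Real.exp (-(v * x)) * (x ^ (z.re + 1) * (Real.exp ‖z‖ * (1 + x ^ ‖z‖))) := by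
            gcongr; exact norm_phiZ_ofReal_le_rpow hE z hx.le
        _ = Real.exp ‖z‖ * (x ^ (z.re + 1) * Real.exp (-(v * x)) +
              (x ^ (z.re + 1) * x ^ ‖z‖) * Real.exp (-(v * x))) := by ring
        _ = _ := by rw [← Real.rpow_add hx]
    have h0 : Tendsto (fun x : ℝ => Real.exp ‖z‖ * (x ^ (z.re + 1) * Real.exp (-(v * x)) +
        x ^ (z.re + 1 + ‖z‖) * Real.exp (-(v * x)))) atTop (𝓝 0) := by
      have t1 := tendsto_rpow_mul_exp_neg_mul_atTop_nhds_zero (z.re + 1) v hv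
      have t2 := tendsto_rpow_mul_exp_neg_mul_atTop_nhds_zero (z.re + 1 + ‖z‖) v hv
      have := ((t1.add t2).const_mul (Real.exp ‖z‖))
      simp only [add_zero, mul_zero] at this
      refine this.congr' (Eventually.of_forall fun x => ?_)
      simp only [neg_mul]
    refine squeeze_zero_norm' ?_ h0
    filter_upwards [eventually_gt_atTop (0:ℝ)] with x hx using hb x hx
  -- integrability of `u'`
  have i1 := integrableOn_cexp_cpow_phiZ hE hz hv
  have i2 := (integrableOn_mul_cexp_cpow_phiZ hE hz hv).const_mul (v : ℂ)
  have i3 := (integrableOn_cexp_cpow_phiZ hE hz (by linarith : 0 < v + 1)).const_mul z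
  have hint : IntegrableOn u' (Ioi 0) := (i1.sub i2).add i3
  have hFTC := integral_Ioi_of_hasDerivAt_of_tendsto hcont.continuousWithinAt hderiv hint hlim
  rw [hu0, sub_zero] at hFTC
  have hsplit : ∫ x in Ioi (0:ℝ), u' x =
      ((∫ x in Ioi (0:ℝ), Complex.exp (-((v : ℂ) * x)) * (x : ℂ) ^ z * phiZ z x) -
        (v : ℂ) * (∫ x in Ioi (0:ℝ), (x : ℂ) *
          (Complex.exp (-((v : ℂ) * x)) * (x : ℂ) ^ z * phiZ z x))) +
      z * ∫ x in Ioi (0:ℝ), Complex.exp (-(((v + 1 : ℝ) : ℂ) * x)) * (x : ℂ) ^ z * phiZ z x := by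
    rw [← integral_const_mul, ← integral_const_mul, ← integral_sub i1 i2, ← integral_add ?_ i3]
    exact i1.sub i2
  rw [← hsplit]
  exact hFTC

/-- **(A) The adjoint equation for the unregularised adjoint** (`Re z > -1`): `d/dw [w g(w)] = -z
g(w+1)` at `w = v > 0`, `g(w) = ∫_0^∞ e^{-wx} x^z φ_z(x) dx`. -/
theorem hasDerivAt_mul_integral_phiZ (hE : MGEin) {z : ℂ} (hz : -1 < z.re) {v : ℝ} (hv : 0 < v) :
    HasDerivAt (fun w : ℝ => (w : ℂ) *
        ∫ x in Ioi (0:ℝ), Complex.exp (-((w : ℂ) * x)) * (x : ℂ) ^ z * phiZ z x)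
      (-z * ∫ x in Ioi (0:ℝ), Complex.exp (-(((v + 1 : ℝ) : ℂ) * x)) * (x : ℂ) ^ z * phiZ z x) v := by
  have hI := hasDerivAt_integral_cexp_neg_mul₃ (A := fun x : ℝ => (x : ℂ) ^ z)
    (R := fun x : ℝ => phiZ z x) (continuousOn_cpow_mul_phiZ hE z z) hv
    (integrableOn_majorant (a := z.re) (b := z.re + ‖z‖) (Real.exp ‖z‖) (half_pos hv) hz
      (by linarith [norm_nonneg z])) (fun x hx => by
      calc (1 + x) * Real.exp (-(v / 2 * x)) * ‖(x : ℂ) ^ z * phiZ z x‖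
          ≤ (1 + x) * Real.exp (-(v / 2 * x)) * (Real.exp ‖z‖ * (x ^ z.re + x ^ (z.re + ‖z‖))) :=
            mul_le_mul_of_nonneg_left (norm_cpow_mul_phiZ_le hE z hx) (by positivity)
        _ = Real.exp ‖z‖ * ((1 + x) * Real.exp (-(v / 2 * x)) * (x ^ z.re + x ^ (z.re + ‖z‖))) := by
            ring)
  have hprod := (hasDerivAt_ofReal v).fun_mul hI
  refine hprod.congr_deriv ?_
  have hibp := integral_ibp_phiZ hE hz hv
  linear_combination hibp

/-- **The adjoint equation on the half-plane `Re z > -1`** ((A) + (B)): `d/dv [v · adjTilde N z v] = -z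
· adjTilde N z (v+1)`. -/
theorem hasDerivAt_mul_adjTilde_of_re_gt (hE : MGEin) (N : ℕ) {z : ℂ} (hz : -1 < z.re) {v : ℝ}
    (hv : 0 < v) :
    HasDerivAt (fun w : ℝ => (w : ℂ) * adjTilde N z w) (-z * adjTilde N z (v + 1)) v := by
  set c := Complex.exp ((Real.eulerMascheroniConstant : ℂ) * z) * (Complex.Gamma (1 + z))⁻¹ with hc
  have heq : ∀ w : ℝ, 0 < w → adjTilde N z w =
      c * ∫ x in Ioi (0:ℝ), Complex.exp (-((w : ℂ) * x)) * (x : ℂ) ^ z * phiZ z x :=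
    fun w hw => adjTilde_eq_of_re_gt hE N hz hw
  have h1 := (hasDerivAt_mul_integral_phiZ hE hz hv).const_mul c
  have h2 : HasDerivAt (fun w : ℝ => (w : ℂ) * adjTilde N z w)
      (c * (-z * ∫ x in Ioi (0:ℝ), Complex.exp (-(((v + 1 : ℝ) : ℂ) * x)) * (x : ℂ) ^ z * phiZ z x))
      v := by
    refine h1.congr_of_eventuallyEq ?_
    filter_upwards [Ioi_mem_nhds hv] with w hw
    rw [heq w hw]; ring
  refine h2.congr_deriv ?_
  rw [heq (v + 1) (by linarith)]
  ring

end AdjEq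

/-- **The adjoint equation on the half-plane `Re z > -1`** (registered helper for the stub `mg_adjointEq`,
line `dip-margin-rate-exchange`): for every `N`, `Re z > -1` and `v > 0`,
`d/dv [v · adjTilde N z v] = -z · adjTilde N z (v + 1)` ((A) integration by parts for the unregularised
adjoint + (B) its identification with the regularised one). -/
theorem mg_adjointEq_halfPlane : MGEin → ∀ N : ℕ, ∀ z : ℂ, -1 < z.re → ∀ v : ℝ, 0 < v → HasDerivAt (fun w : ℝ => (w : ℂ) * adjTilde N z w) (-z * adjTilde N z (v + 1)) v :=
  fun hE N _ hz _ hv => AdjEq.hasDerivAt_mul_adjTilde_of_re_gt hE N hz hv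

end Summit.Parity.GeneralizedHardyLittlewood.Cruxes.AbsoluteUpgrade.DipMarginRateExchange

end
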